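import Summits.BirchSwinnertonDyer.BirchSwinnertonDyer.Theorems.PrintCf2SplitBadTwoLocalControlKernelExact
import Summits.BirchSwinnertonDyer.BirchSwinnertonDyer.Theorems.PrintCf2SplitBadTwoLocalControlKernelDyadicCM
import HarnessLib

/-!
# Crux `PrintCf2.SplitBadTwoRankOneOfFacts` (stmt-BirchSwinnertonDyer-20368), road α v10.3 — brick B15 file 8: the DYADIC LOCAL KERNEL IS EXACT —
# `#LK_{v̄} = 2` under (Hv̄-move) ∧ «`v̄` does not split completely in `K*_∞`», `#LK_{v̄} = 1` under (Hv̄-triv) — the residual (R-DYADIC) of S3c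

Cell `bsd-print-cf2`, width seat `bsd-line-cf2-p1-w2` g9 (prover-bsd-line-cf2-p1-w2-g9-0); brick B15 (memo `Cruxes/SplitBadTwoRankOneOfFacts/B15-DYADIC-EXACT-w2g9.md`
§3, column `#LK_{v̄}`); `--supports stmt-BirchSwinnertonDyer-20368` (helper, Theses-free). HONEST FRAMING: nothing here closes the crux or a registered
stub; BSD is not proved by any of this; no summit statement is proved by this seat. No definition, no named fact, no `sorry`.

WHAT. `LK_w := ker (H¹(⊤ ⊓ D_w, W*) → H¹(ker κ ⊓ D_w, W*))` (⊤-currency of `relIndex_le_prod_natCard_localKer`), `W* = ↥E[𝔮_ρ^∞]`.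
* **`natCard_localKer_top_eq_two_of_exists_smul_ne_of_not_decomp_le`** — ANY finite place `w`, ANY `ℤ₂`-line `κ`: if some `σ ∈ ker κ ⊓ D_w` moves a point of
  `W*[4]` (Hv̄-move) and `D_w ⊄ ker κ` (`w` does not split completely in `K_∞`), then `#LK_w = 2` EXACTLY: `≤ 2` is p661197; `≥ 2` is -w3 g8's
  generic non-zero inflated class `exists_ne_zero_mem_localKer_top_of_not_decomp_le` (p66xxxx), whose hypothesis «`(ker κ ⊓ D_w)`-fixed ⇒ `D_w`-fixed»
  holds because the fixed module lies in `W*[2]` (p661197 `two_nsmul_eq_zero_of_fixed_of_smul_ne`), which `Γ_K` fixes (p656168).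
* frame versions at `v̄` (θ-free, every `κ'`): **`natCard_localKer_vbar_eq_two_of_frame`** ((Hv̄-move) ∧ `¬ decomp v̄ ≤ ker κ'` ⇒ `#LK_{v̄} = 2`, `v₂ = 1`) and
  **`natCard_localKer_vbar_eq_one_of_frame`** ((Hv̄-triv) ⇒ `#LK_{v̄} = 1`, `v₂ = 0`). So the LEAD's residual (R-DYADIC) `v₂ #LK_{v̄} = e_{v̄}([d]₂)` is reduced
  to deciding (Hv̄-triv) vs (Hv̄-move) ∧ non-split — by the memo's CFT table: `e_{v̄} = 0` on keys (1,3), (0,7), `= 1` on (1,7), (0,1), (0,3), (0,5).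
presearch: Greenberg LNM 1716 §3 Lemma 3.3; Agboola 2007 §3 Prop. 3.2 — held; no fact filed. beyond-print theorem: no.

References: [GreenbergLNM1716] §3 Lemma 3.3 (pp. 86–88); [Agboola2007] §3 Prop. 3.2.
-/

noncomputable section

open scoped Classical

set_option linter.dupNamespace false
set_option autoImplicit false

namespace Summit.BirchSwinnertonDyer.BirchSwinnertonDyer.Theorems.PrintCf2.RestrictedSelmerPair

open NumberField IsDedekindDomain Field WeierstrassCurve
open Literature.NumberTheory.EllipticCurves Literature.NumberTheory.EllipticCurves.GreenbergSelmer
open Literature.NumberTheory.GaloisRepresentations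
open Summit.BirchSwinnertonDyer.BirchSwinnertonDyer.Theorems.PrintCf2.AdditiveAtSeven

variable (W : WeierstrassCurve ℚ) [W.IsElliptic] {K : Type} [Field K] [NumberField K]

/-- **`#LK_w = 2` EXACTLY when `ker κ ⊓ D_w` moves `W*[4]` and `D_w ⊄ ker κ`** (`j = −3375`, `θ² = −7` in `K`, `π² = π − 2`, `ρ` either root, ANY finite place
`w`, ANY `ℤ₂`-line `κ`): `≤ 2` by p661197, `≥ 2` by the non-zero inflated class of `exists_ne_zero_mem_localKer_top_of_not_decomp_le` at a generator of
`W*[2]` (fixed by `Γ_K`), the `(ker κ ⊓ D_w)`-fixed module lying in `W*[2]`. [cite: GreenbergLNM1716, §3 Lemma 3.3 (pp. 86–88)] [cite: Agboola2007, §3 Prop. 3.2] -/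
theorem natCard_localKer_top_eq_two_of_exists_smul_ne_of_not_decomp_le (hj : W.j = -3375) {θ : K} (hθ : θ ^ 2 = -7)
    (π : (W.baseChange K).endRing) (hrel : (π : AddMonoid.End (W.baseChange K).geomPoints) * π = π - 2)
    {ρ : ℤ_[2]} (hρ : ρ * ρ = ρ - 2) (w : HeightOneSpectrum (𝓞 K)) (κ : ZpExtension K 2)
    (hmove : ∃ σ ∈ κ.kerSubgroup ⊓ decomp w, ∃ x : ↥((W.baseChange K).endEigenPrimaryTorsion 2 π ρ), 4 • x = 0 ∧ σ • x ≠ x)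
    (hw : ¬ decomp w ≤ κ.kerSubgroup) :
    Nat.card (resOfLe ↥((W.baseChange K).endEigenPrimaryTorsion 2 π ρ)
        (inf_le_inf_right (decomp w) (le_top : κ.kerSubgroup ≤ ⊤))).ker = 2 := by
  haveI : Fact (Nat.Prime 2) := ⟨Nat.prime_two⟩
  set C := (W.baseChange K).endEigenPrimaryTorsion 2 π ρ with hC_def
  obtain ⟨hfin, hle⟩ := natCard_localKer_top_le_two_of_exists_smul_ne W hj hθ π hrel hρ w κ hmove
  haveI := hfin
  obtain ⟨-, -, -, -, -, -, hgen, -⟩ := CMPrimes.endEigenPrimaryTorsion_two_structure W hj K hθ π hrel hρ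
  obtain ⟨g, hg, hord, -⟩ := hgen 1
  have hg2 : 2 • g = 0 := by
    have h := addOrderOf_nsmul_eq_zero g
    rwa [hord, pow_one] at h
  have hg0 : g ≠ 0 := fun h ↦ by
    have h1 : addOrderOf g = 1 := by rw [h, addOrderOf_zero]
    rw [hord] at h1; norm_num at h1
  let t : ↥C := ⟨g, hg⟩
  have ht0 : t ≠ 0 := fun h ↦ hg0 (congrArg Subtype.val h)
  have hpt : 2 • t = 0 := Subtype.ext (by
    change 2 • g = 0
    exact hg2)
  have hDt : ∀ δ ∈ decomp w, δ • t = t := fun δ _ ↦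
    Subtype.ext (CMPrimes.smul_eq_self_of_two_nsmul_eq_zero W K hj hθ π hrel hρ δ g hg hg2)
  -- the `(ker κ ⊓ D_w)`-fixed module lies in `W*[2]`, hence is fixed by `D_w`
  have hS : ∃ σ ∈ ((κ.kerSubgroup ⊓ decomp w : Subgroup (absoluteGaloisGroup K)) : Set (absoluteGaloisGroup K)),
      ∃ x ∈ C, 4 • x = 0 ∧ σ • x ≠ x := by
    obtain ⟨σ, hσ, x, hx4, hσx⟩ := hmove
    refine ⟨σ, hσ, (x : (W.baseChange K).geomPrimaryTorsion 2), x.2, ?_, fun h ↦ hσx (Subtype.ext h)⟩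
    have := congrArg (fun z : ↥C ↦ (z : (W.baseChange K).geomPrimaryTorsion 2)) hx4
    simpa only [AddSubmonoidClass.coe_nsmul, ZeroMemClass.coe_zero] using this
  have hfix : ∀ m : ↥C, (∀ σ ∈ κ.kerSubgroup ⊓ decomp w, σ • m = m) → ∀ δ ∈ decomp w, δ • m = m := by
    intro m hm δ _
    have h2m : 2 • (m : (W.baseChange K).geomPrimaryTorsion 2) = 0 :=
      CMPrimes.two_nsmul_eq_zero_of_fixed_of_smul_ne W K hj hθ π hrel hρ _ hS m.2 (fun σ hσ ↦ congrArg Subtype.val (hm σ hσ))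
    exact Subtype.ext (CMPrimes.smul_eq_self_of_two_nsmul_eq_zero W K hj hθ π hrel hρ δ _ m.2 h2m)
  obtain ⟨c, hc, hc0, -⟩ := exists_ne_zero_mem_localKer_top_of_not_decomp_le κ ↥C w ht0 hpt hDt hfix hw
  have hlt : 1 < Nat.card (resOfLe ↥C (inf_le_inf_right (decomp w) (le_top : κ.kerSubgroup ≤ ⊤))).ker :=
    Finite.one_lt_card_iff_nontrivial.mpr ⟨⟨⟨c, hc⟩, 0, fun h ↦ hc0 (congrArg Subtype.val h)⟩⟩
  exact le_antisymm hle hlt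

/-- **ROAD α, (R-DYADIC), case `e_{v̄} = 1`: `#LK_{v̄} = 2`** on every S3c frame (`C • W = cm7^{(d)}`, `K` imaginary quadratic, `v̄ ∣ 2`, `π² = π − 2` in `End_K(E_K)`,
`r² = r − 2`, ANY `κ'`; no `θ`-binder) provided some element of `ker κ' ⊓ D_{v̄}` moves a point of `W*[4]` and `D_{v̄} ⊄ ker κ'` (both true for the CFT
line iff `d ≢ 3 (8)` and `d ≢ 14 (16)`, memo (C1)/(C3) — not claimed here). [cite: Agboola2007, §3 Prop. 3.2] [cite: GreenbergLNM1716, §3 Lemma 3.3] -/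
theorem natCard_localKer_vbar_eq_two_of_frame {d : ℤ} (hd0 : d ≠ 0) (W : WeierstrassCurve ℚ) [W.IsElliptic]
    (C : VariableChange ℚ) (hC : C • W = cm7.quadraticTwist (d : ℚ))
    (vbar : HeightOneSpectrum (𝓞 K)) (π : (W.baseChange K).endRing)
    (hrel : (π : AddMonoid.End (W.baseChange K).geomPoints) * π = π - 2) {r : ℤ_[2]} (hr : r * r = r - 2) (κ' : ZpExtension K 2)
    (hmove : ∃ σ ∈ κ'.kerSubgroup ⊓ decomp vbar, ∃ x : ↥((W.baseChange K).endEigenPrimaryTorsion 2 π r), 4 • x = 0 ∧ σ • x ≠ x)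
    (hw : ¬ decomp vbar ≤ κ'.kerSubgroup) :
    Nat.card (resOfLe ↥((W.baseChange K).endEigenPrimaryTorsion 2 π r)
        (inf_le_inf_right (decomp vbar) (le_top : κ'.kerSubgroup ≤ ⊤))).ker = 2 := by
  have hj : W.j = -3375 := j_eq_of_smul_eq_cm7Twist hd0 W C hC
  obtain ⟨θ, hθ⟩ := exists_sq_eq_neg_seven_of_cmEndo_mem_endRing W K hj π hrel
  exact natCard_localKer_top_eq_two_of_exists_smul_ne_of_not_decomp_le W hj hθ π hrel hr vbar κ' hmove hw

/-- **ROAD α, (R-DYADIC), case `e_{v̄} = 0`: `#LK_{v̄} = 1`** on every S3c frame (`v̄ ≠ v` above `2`, ANY `κ'`; no `θ`-binder) provided `ker κ' ⊓ D_{v̄}` fixes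
`W*` pointwise (true for the CFT line iff `d ≡ 3 (8)` or `d ≡ 14 (16)`): `LK_{v̄} = ⊥` by p661197. [cite: Agboola2007, §3 Prop. 3.2] -/
theorem natCard_localKer_vbar_eq_one_of_frame {d : ℤ} (hd0 : d ≠ 0) (W : WeierstrassCurve ℚ) [W.IsElliptic]
    (C : VariableChange ℚ) (hC : C • W = cm7.quadraticTwist (d : ℚ)) (hK : IsImaginaryQuadratic K)
    (v vbar : HeightOneSpectrum (𝓞 K)) (hv : ((2 : ℕ) : 𝓞 K) ∈ v.asIdeal) (hvbar : ((2 : ℕ) : 𝓞 K) ∈ vbar.asIdeal)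
    (hne : vbar ≠ v) (π : (W.baseChange K).endRing) (hrel : (π : AddMonoid.End (W.baseChange K).geomPoints) * π = π - 2)
    {r : ℤ_[2]} (hr : r * r = r - 2) (κ' : ZpExtension K 2)
    (htriv : ∀ σ ∈ κ'.kerSubgroup ⊓ decomp vbar, ∀ x : ↥((W.baseChange K).endEigenPrimaryTorsion 2 π r), σ • x = x) :
    Nat.card (resOfLe ↥((W.baseChange K).endEigenPrimaryTorsion 2 π r)
        (inf_le_inf_right (decomp vbar) (le_top : κ'.kerSubgroup ≤ ⊤))).ker = 1 := by
  rw [localKer_vbar_eq_bot_of_frame hd0 W C hC hK v vbar hv hvbar hne π hrel hr κ' htriv, AddSubgroup.card_bot]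

end Summit.BirchSwinnertonDyer.BirchSwinnertonDyer.Theorems.PrintCf2.RestrictedSelmerPair

end
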